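import Mathlib.MeasureTheory.Measure.Real
import Mathlib.MeasureTheory.Measure.Typeclasses.Probability
import HarnessLib

/-!
# Newman–Tassion–Wu 2017, §3.2, proof of Theorem 3.7, first part: from Facts 1 and 2 to the
# high-probability gluing function `h₁` — the bookkeeping, once, in the abstract

Topic: `Literature/Probability/Percolation`. In the proof of their main gluing lemma (Thm. 3.7;
arXiv:1512.09107, pp. 9–10) Newman–Tassion–Wu split the bad event `𝒳 = {C ⟷ near Γ̄} ∖ {C ⟷ A}`
according to the size of the contact set `U(ω)` and prove

* **Fact 1.** `P[𝒳 ∩ {|U| ≤ t}] ≤ C₁^t · P[(C ⟷ near Γ̄)ᶜ]` (anti-gluing map, Lemma 3.5 with `t = 1`);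
* **Fact 2.** `P[𝒳 ∩ {|U| > t}] ≤ (C₂/(t-8)) · P[𝒳′]`, `𝒳′ = {C ⟷ near Γ̄} ∩ {C ⟷ A}` (multi-valued
  local surgery, Lemma 3.5),

with `C₁, C₂` depending only on `ε` and `k`, and conclude: "Setting `t = log|log(1-x)|` … one can
easily construct `δ > 0` and a function `h₁ : [1-δ,1] → [0,1]` that is continuous, strictly
increasing …, with `h₁(1) = 1`" such that `P[𝒳′] ≥ h₁(P[C ⟷ near Γ̄])`.  Every later use of the
high-probability regime (Lemma 3.11, Theorem 3.17, Prop. 3.9 iterated near `1`) consumes exactly the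
`ε-δ` content of this: **for every `η > 0` there is `δ > 0`, depending only on `C₁, C₂, η`, such that
`P[near] ≥ 1 - δ ⟹ P[glued] ≥ 1 - η`.**  This file proves that implication ONCE, for an arbitrary
probability space, events `X′ ⊆ N` ("glued" ⊆ "near") and statistic `card : Ω → ℕ`, from the two
displayed inequalities — so that the gluing layer of the port only has to establish Facts 1 and 2
(in general position) and can quote the `ε-δ` conclusion in the form the tree's
`NTW17.lemma311_of` / `h360_of` take as hypotheses (H38), (H39).

* `NTW17.exists_delta_of_facts` — the uniform `ε-δ` statement (δ = η / (2(1 + C₁^t)) with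
  `t = ⌈9 + 2C₂/η⌉`); no measurability is needed (outer-measure subadditivity suffices).
* `NTW17.glued_ge_of_facts` — the pointwise inequality `P[X′] ≥ (P[N] - C₁^t (1 - P[N])) / (1 + C₂/(t-8))`
  (the display before "Setting `t = …`").

## Sources

* C. M. Newman, V. Tassion, W. Wu, *Critical percolation and the minimal spanning tree in
  slabs*, Comm. Pure Appl. Math. 70 (2017) 2084–2120, arXiv:1512.09107: §3.2, proof of
  Theorem 3.7, first part (Facts 1–2 and the construction of `h₁`, pp. 9–10 of the arXiv text)
  [NewmanTassionWu2017].
* H. Duminil-Copin, V. Sidoravicius, V. Tassion, CPAM 69 (2016), §2.3 ("choosing first `t` as in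
  Fact 2 and then `δ` as in Fact 1"; the tree's `DuminilCopinSidoraviciusTassion2016_lemma6_of_facts`
  is the same bookkeeping in DST's special geometry) [DuminilCopinSidoraviciusTassion2016].
-/

noncomputable section

namespace Literature.Probability.Percolation

open MeasureTheory

namespace NTW17

universe u

/-- **The display before "Setting `t = log|log(1-x)|`"**: from Fact 1 and Fact 2 at level `t`,
`(1 + C₂/(t-8)) · P[X′] ≥ P[N] - C₁^t (1 - P[N])` for events `X′ ⊆ N` of a probability space
(`N` measurable). [cite: NewmanTassionWu2017, §3.2 (proof of Theorem 3.7, first part)] -/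
theorem glued_ge_of_facts {Ω : Type u} [MeasurableSpace Ω] (μ : Measure Ω) [IsProbabilityMeasure μ]
    {N X' : Set Ω} (hN : MeasurableSet N) (card : Ω → ℕ) {C₁ C₂ : ℝ} {t : ℕ}
    (fact1 : μ.real ((N \ X') ∩ {ω | card ω ≤ t}) ≤ C₁ ^ t * μ.real Nᶜ)
    (fact2 : μ.real ((N \ X') ∩ {ω | t < card ω}) ≤ C₂ / ((t : ℝ) - 8) * μ.real X') :
    μ.real N - C₁ ^ t * (1 - μ.real N) ≤ (1 + C₂ / ((t : ℝ) - 8)) * μ.real X' := by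
  -- `P[N] ≤ P[X'] + P[N \ X']` and `P[N \ X'] ≤ Fact 1 + Fact 2`
  have h1 : μ.real N ≤ μ.real X' + μ.real (N \ X') := by
    calc μ.real N ≤ μ.real (X' ∪ (N \ X')) := measureReal_mono (fun ω hω => by
          by_cases h : ω ∈ X'
          · exact Or.inl h
          · exact Or.inr ⟨hω, h⟩) (measure_ne_top _ _)
      _ ≤ μ.real X' + μ.real (N \ X') := measureReal_union_le _ _
  have h2 : μ.real (N \ X') ≤
      μ.real ((N \ X') ∩ {ω | card ω ≤ t}) + μ.real ((N \ X') ∩ {ω | t < card ω}) := by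
    calc μ.real (N \ X')
        ≤ μ.real (((N \ X') ∩ {ω | card ω ≤ t}) ∪ ((N \ X') ∩ {ω | t < card ω})) :=
          measureReal_mono (fun ω hω => by
            by_cases h : card ω ≤ t
            · exact Or.inl ⟨hω, h⟩
            · exact Or.inr ⟨hω, lt_of_not_ge h⟩) (measure_ne_top _ _)
      _ ≤ _ := measureReal_union_le _ _
  have h3 : μ.real Nᶜ = 1 - μ.real N := probReal_compl_eq_one_sub hN
  rw [h3] at fact1
  linarith

/-- **NTW 2017, proof of Theorem 3.7, first part — the `ε-δ` content of `h₁`, uniformly.**  For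
constants `C₁ ≥ 1`, `C₂ ≥ 0` and `η > 0` there is `δ > 0` (namely `η / (2(1 + C₁^t))`,
`t = ⌈2C₂/η⌉ + 9`) such that in ANY probability space, for any events `X′ ⊆ N` (`N` measurable)
and statistic `card` satisfying Fact 1 (`P[(N ∖ X′) ∩ {card ≤ t}] ≤ C₁^t P[Nᶜ]`) and Fact 2
(`P[(N ∖ X′) ∩ {card > t}] ≤ (C₂/(t-8)) P[X′]`) at that level `t`:  `P[N] ≥ 1 - δ ⟹ P[X′] ≥ 1 - η`.
The uniformity of `δ` in the geometric data is what Lemma 3.11 / Theorem 3.17 use.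
[cite: NewmanTassionWu2017, §3.2 (proof of Theorem 3.7, first part: "one can easily construct δ > 0 and a function h₁")] -/
theorem exists_delta_of_facts {C₁ C₂ η : ℝ} (hC₁ : 1 ≤ C₁) (hC₂ : 0 ≤ C₂) (hη : 0 < η) :
    ∃ t : ℕ, 8 < t ∧ ∃ δ : ℝ, 0 < δ ∧
      ∀ {Ω : Type u} [MeasurableSpace Ω] (μ : Measure Ω) [IsProbabilityMeasure μ]
        (N X' : Set Ω) (card : Ω → ℕ), MeasurableSet N →
        μ.real ((N \ X') ∩ {ω | card ω ≤ t}) ≤ C₁ ^ t * μ.real Nᶜ →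
        μ.real ((N \ X') ∩ {ω | t < card ω}) ≤ C₂ / ((t : ℝ) - 8) * μ.real X' →
        1 - δ ≤ μ.real N → 1 - η ≤ μ.real X' := by
  -- `t` with `C₂/(t-8) ≤ η/2`
  obtain ⟨t₀, ht₀⟩ := exists_nat_gt (2 * C₂ / η)
  set t : ℕ := t₀ + 9 with ht
  have ht8 : (8 : ℝ) < t := by rw [ht]; push_cast; linarith [Nat.cast_nonneg (α := ℝ) t₀]
  have hκ0 : 0 ≤ C₂ / ((t : ℝ) - 8) := div_nonneg hC₂ (by linarith)
  have hκ : C₂ / ((t : ℝ) - 8) ≤ η / 2 := by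
    rw [div_le_iff₀ (by linarith)]
    have h1 : (t : ℝ) - 8 = t₀ + 1 := by rw [ht]; push_cast; ring
    rw [h1]
    have h2 : 2 * C₂ / η < t₀ := ht₀
    rw [div_lt_iff₀ hη] at h2
    nlinarith
  -- `δ = η / (2 (1 + C₁^t))`
  set L : ℝ := C₁ ^ t with hL
  have hL1 : 1 ≤ L := one_le_pow₀ hC₁
  refine ⟨t, by exact_mod_cast (show (8 : ℝ) < t from ht8), η / (2 * (1 + L)), by positivity, ?_⟩
  intro Ω _ μ _ N X' card hN f1 f2 hNδ
  have key := glued_ge_of_facts μ hN card f1 f2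
  have hXle : μ.real X' ≤ 1 := measureReal_le_one
  have hX0 : 0 ≤ μ.real X' := measureReal_nonneg
  -- `P[N] - L (1 - P[N]) ≥ 1 - η/2`
  have hlow : 1 - η / 2 ≤ μ.real N - L * (1 - μ.real N) := by
    have hN1 : μ.real N ≤ 1 := measureReal_le_one
    have : L * (1 - μ.real N) ≤ L * (η / (2 * (1 + L))) :=
      mul_le_mul_of_nonneg_left (by linarith) (by linarith)
    have hsum : L * (η / (2 * (1 + L))) + η / (2 * (1 + L)) = η / 2 := by
      field_simp
      ring
    linarith
  -- `(1 + κ) P[X'] ≥ 1 - η/2` with `κ ≤ η/2` gives `P[X'] ≥ 1 - η`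
  set κ : ℝ := C₂ / ((t : ℝ) - 8) with hκdef
  have h4 : 1 - η / 2 ≤ (1 + κ) * μ.real X' := hlow.trans key
  nlinarith

end NTW17

end Literature.Probability.Percolation

end
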